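import Mathlib
import HarnessLib
import Summits.HubbardSuperconductivity.HubbardSuperconductivity.Theorems.KLProgrammePerturbedFermiCurveCompChainStruct
import Summits.HubbardSuperconductivity.HubbardSuperconductivity.Theorems.KLProgrammeKLRegimeTwoLegCurvatureDefs
import Summits.HubbardSuperconductivity.HubbardSuperconductivity.Theorems.KLProgrammeKLRegimeSplitTwoLegIncrementSizes

/-!
# K3 ENGINE child (stmt-HubbardSuperconductivity-20236 `KLRegimeEngineV16`), stub 6 `TwoLegCurveJetBound … K n`: the INHERITED curve-jet
# terms of the profile `δ_n = G_n ∘ γ_K` — the reverse Faà di Bruno inequalities and what the single-slot k = 3, 4 clauses force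

Cell gate-hubbard-kl, seat hubbard-kl-k3c5-p1 (g8; row (b) «Matsubara / analytic suppliers»).  Companion of the memo
HOME/hubbard-kl-k3c5-p1/g8/STUB6-K34-INHERITED-JETS.md (evidence on 20236, 2026-08-27).

The curve profile of p2's stub-6 predicate (`…TwoLegCurvatureDefs`) is a COMPOSITE: `δ_{n+1} = G_{n+1} ∘ γ_K` with the momentum-space
increment `G_{n+1} = evalM (symInterp L (σ_{n+1} − σ_n))` and the Fermi-point map `γ_K θ = toLp 2 (klFermiPoint μ K θ)` of the FULL frame
(`klLocalPart_sub_eq_evalM_comp`, k3c3-p3); at `n = 0`, `δ₀ = (evalM (symInterp L σ₀) − evalM K) ∘ γ_K`.  k3c3-p3's structured chain rule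
(`…PerturbedFermiCurveCompChainStruct`) bounds `|∂⁴(F∘γ)|` by `M₄D₁⁴ + 6M₃D₁²D₂ + 3M₂D₂² + 4M₂D₁D₃ + M₁D₄`; the LAST term — the gradient
of the increment against the FOURTH derivative of the curve, `DF(γ θ)[γ⁗ θ]` — is the one the scale-`n` single-slot budget
`curveJetBar c c' U 4 n ∝ 16ⁿ` cannot absorb when the frame is deep (`‖γ_K⁗‖ ≍ A₄ = Gfr₄U²16^{N+1}/15`, …HigherDerivsFrame).
This file proves the REVERSE inequalities that isolate it:

* §1 (generic, any real normed space): `|DF(γθ)[γ‴θ]| ≤ |∂³(F∘γ)θ| + (M₃D₁³ + 3M₂D₁D₂)` and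
  `|DF(γθ)[γ⁗θ]| ≤ |∂⁴(F∘γ)θ| + (M₄D₁⁴ + 6M₃D₁²D₂ + 3M₂D₂² + 4M₂D₁D₃)` — from the exact order-3/4 chain expressions
  `iteratedDeriv_three/four_comp_eq` (k3c3-p3), no `M₁`, no `D₃`/`D₄` on the right;
* §2 (model reading): the profile as a composite at `n = 0` and `n + 1`, and under `TwoLegCurveJetBound L M c c' β U μ K n` the inherited
  products are forced below `curveJetBar c c' U 3/4 n` plus budget-shaped terms (`TwoLegCurveJetBound.inherited_three/four_le_succ/_zero`),
  with the contrapositive `not_twoLegCurveJetBound_…_of_inherited_gt` — the inequality a refuter confronts with an `A₄`-saturating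
  admissible frame (memo §3: at the top of the β-window it fails for every `n ≲ 2N/3` in scheme C).

Everything is PROVED; no definitions; nothing about the Hubbard model is asserted beyond unfolding the profile.
References: Faà di Bruno [folklore]; BGM 2006 §2.4 (2.36)/(2.40) [cite: BenfattoGiulianiMastropietro2006].
-/

noncomputable section

namespace Summit.HubbardSuperconductivity.HubbardSuperconductivity.Theorems.PerturbedFermiCurve

set_option linter.dupNamespace false -- summit = problem name (single-conjunct summit), D-0017
set_option maxSynthPendingDepth 3 -- nested operator-norm instances (third/fourth Fréchet derivatives)

open Real Set Finset

/-! ## §1 The reverse chain-rule inequalities (generic) -/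

section Reverse

variable {V : Type*} [NormedAddCommGroup V] [NormedSpace ℝ V] {F : V → ℝ} {γ : ℝ → V}
  (hF : ContDiff ℝ 4 F) (hγ : ContDiff ℝ 4 γ) {θ M₂ M₃ M₄ D₁ D₂ D₃ : ℝ}
  (hM₂ : ‖iteratedFDeriv ℝ 2 F (γ θ)‖ ≤ M₂) (hM₃ : ‖iteratedFDeriv ℝ 3 F (γ θ)‖ ≤ M₃)
  (hM₄ : ‖iteratedFDeriv ℝ 4 F (γ θ)‖ ≤ M₄)
  (hD₁ : ‖iteratedDeriv 1 γ θ‖ ≤ D₁) (hD₂ : ‖iteratedDeriv 2 γ θ‖ ≤ D₂) (hD₃ : ‖iteratedDeriv 3 γ θ‖ ≤ D₃)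
include hF hγ

section Three
include hM₂ hM₃ hD₁ hD₂

/-- **Order 3, reversed**: the gradient-against-`γ‴` term is within the budget-shaped terms of the third derivative of the composite:
`|DF(γ θ)[γ‴ θ]| ≤ |∂³(F∘γ)(θ)| + (M₃·D₁³ + 3·M₂·D₁·D₂)`. [folklore] -/
theorem abs_fderiv_apply_iteratedDeriv_three_le_struct :
    |fderiv ℝ F (γ θ) (iteratedDeriv 3 γ θ)| ≤ |iteratedDeriv 3 (F ∘ γ) θ| + (M₃ * D₁ ^ 3 + 3 * M₂ * D₁ * D₂) := by
  have heq := iteratedDeriv_three_comp_eq hF hγ θ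
  have hE₂ : ‖fderiv ℝ (fderiv ℝ F) (γ θ)‖ ≤ M₂ := by rw [norm_fderiv_two_eq_norm_iteratedFDeriv]; exact hM₂
  have hE₃ : ‖fderiv ℝ (fderiv ℝ (fderiv ℝ F)) (γ θ)‖ ≤ M₃ := by rw [norm_fderiv_three_eq_norm_iteratedFDeriv]; exact hM₃
  have hM20 : 0 ≤ M₂ := (norm_nonneg _).trans hE₂; have hM30 : 0 ≤ M₃ := (norm_nonneg _).trans hE₃
  have hD10 : 0 ≤ D₁ := (norm_nonneg _).trans hD₁; have hD20 : 0 ≤ D₂ := (norm_nonneg _).trans hD₂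
  set v₁ := iteratedDeriv 1 γ θ; set v₂ := iteratedDeriv 2 γ θ; set v₃ := iteratedDeriv 3 γ θ
  have h3 : |fderiv ℝ (fderiv ℝ (fderiv ℝ F)) (γ θ) v₁ v₁ v₁| ≤ M₃ * D₁ ^ 3 := by
    calc _ ≤ M₃ * ‖v₁‖ * ‖v₁‖ * ‖v₁‖ := abs_apply₃_le_of_opNorm_le _ hE₃ _ _ _
      _ ≤ M₃ * D₁ * D₁ * D₁ := by gcongr
      _ = M₃ * D₁ ^ 3 := by ring
  have h21 : |fderiv ℝ (fderiv ℝ F) (γ θ) v₂ v₁| ≤ M₂ * D₁ * D₂ := by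
    calc _ ≤ M₂ * ‖v₂‖ * ‖v₁‖ := abs_apply₂_le_of_opNorm_le _ hE₂ _ _
      _ ≤ M₂ * D₂ * D₁ := by gcongr
      _ = M₂ * D₁ * D₂ := by ring
  have h12 : |fderiv ℝ (fderiv ℝ F) (γ θ) v₁ v₂| ≤ M₂ * D₁ * D₂ := by
    calc _ ≤ M₂ * ‖v₁‖ * ‖v₂‖ := abs_apply₂_le_of_opNorm_le _ hE₂ _ _
      _ ≤ M₂ * D₁ * D₂ := by gcongr
  have key : fderiv ℝ F (γ θ) v₃ = iteratedDeriv 3 (F ∘ γ) θ -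
      (fderiv ℝ (fderiv ℝ (fderiv ℝ F)) (γ θ) v₁ v₁ v₁ + fderiv ℝ (fderiv ℝ F) (γ θ) v₂ v₁ +
        fderiv ℝ (fderiv ℝ F) (γ θ) v₁ v₂ + fderiv ℝ (fderiv ℝ F) (γ θ) v₁ v₂) := by
    rw [heq]; ring
  have hS := abs_add_le_add (abs_add_le_add (abs_add_le_add h3 h21) h12) h12
  rw [key]
  calc _ ≤ |iteratedDeriv 3 (F ∘ γ) θ| + |fderiv ℝ (fderiv ℝ (fderiv ℝ F)) (γ θ) v₁ v₁ v₁ +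
          fderiv ℝ (fderiv ℝ F) (γ θ) v₂ v₁ + fderiv ℝ (fderiv ℝ F) (γ θ) v₁ v₂ + fderiv ℝ (fderiv ℝ F) (γ θ) v₁ v₂| :=
        abs_sub _ _
    _ ≤ |iteratedDeriv 3 (F ∘ γ) θ| + (M₃ * D₁ ^ 3 + 3 * M₂ * D₁ * D₂) := by
        refine add_le_add le_rfl (hS.trans (le_of_eq ?_)); ring

end Three

section Four
include hM₂ hM₃ hM₄ hD₁ hD₂ hD₃

/-- **Order 4, reversed**: the gradient-against-`γ⁗` term (the INHERITED term of a deep curve) is within the budget-shaped terms of the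
fourth derivative of the composite: `|DF(γ θ)[γ⁗ θ]| ≤ |∂⁴(F∘γ)(θ)| + (M₄·D₁⁴ + 6·M₃·D₁²·D₂ + 3·M₂·D₂² + 4·M₂·D₁·D₃)` — no `M₁` and
no `D₄` on the right. [folklore] -/
theorem abs_fderiv_apply_iteratedDeriv_four_le_struct :
    |fderiv ℝ F (γ θ) (iteratedDeriv 4 γ θ)| ≤
      |iteratedDeriv 4 (F ∘ γ) θ| + (M₄ * D₁ ^ 4 + 6 * M₃ * D₁ ^ 2 * D₂ + 3 * M₂ * D₂ ^ 2 + 4 * M₂ * D₁ * D₃) := by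
  have heq := iteratedDeriv_four_comp_eq hF hγ θ
  have hE₂ : ‖fderiv ℝ (fderiv ℝ F) (γ θ)‖ ≤ M₂ := by rw [norm_fderiv_two_eq_norm_iteratedFDeriv]; exact hM₂
  have hE₃ : ‖fderiv ℝ (fderiv ℝ (fderiv ℝ F)) (γ θ)‖ ≤ M₃ := by rw [norm_fderiv_three_eq_norm_iteratedFDeriv]; exact hM₃
  have hE₄ : ‖fderiv ℝ (fderiv ℝ (fderiv ℝ (fderiv ℝ F))) (γ θ)‖ ≤ M₄ := by
    rw [norm_fderiv_four_eq_norm_iteratedFDeriv]; exact hM₄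
  have hM20 : 0 ≤ M₂ := (norm_nonneg _).trans hE₂; have hM30 : 0 ≤ M₃ := (norm_nonneg _).trans hE₃
  have hM40 : 0 ≤ M₄ := (norm_nonneg _).trans hM₄
  have hD10 : 0 ≤ D₁ := (norm_nonneg _).trans hD₁; have hD20 : 0 ≤ D₂ := (norm_nonneg _).trans hD₂
  have hD30 : 0 ≤ D₃ := (norm_nonneg _).trans hD₃
  set v₁ := iteratedDeriv 1 γ θ; set v₂ := iteratedDeriv 2 γ θ; set v₃ := iteratedDeriv 3 γ θ; set v₄ := iteratedDeriv 4 γ θ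
  have h4 : |fderiv ℝ (fderiv ℝ (fderiv ℝ (fderiv ℝ F))) (γ θ) v₁ v₁ v₁ v₁| ≤ M₄ * D₁ ^ 4 := by
    calc _ ≤ M₄ * ‖v₁‖ * ‖v₁‖ * ‖v₁‖ * ‖v₁‖ := abs_apply₄_le_of_opNorm_le _ hE₄ _ _ _ _
      _ ≤ M₄ * D₁ * D₁ * D₁ * D₁ := by gcongr
      _ = M₄ * D₁ ^ 4 := by ring
  have h211 : |fderiv ℝ (fderiv ℝ (fderiv ℝ F)) (γ θ) v₂ v₁ v₁| ≤ M₃ * D₁ ^ 2 * D₂ := by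
    calc _ ≤ M₃ * ‖v₂‖ * ‖v₁‖ * ‖v₁‖ := abs_apply₃_le_of_opNorm_le _ hE₃ _ _ _
      _ ≤ M₃ * D₂ * D₁ * D₁ := by gcongr
      _ = M₃ * D₁ ^ 2 * D₂ := by ring
  have h121 : |fderiv ℝ (fderiv ℝ (fderiv ℝ F)) (γ θ) v₁ v₂ v₁| ≤ M₃ * D₁ ^ 2 * D₂ := by
    calc _ ≤ M₃ * ‖v₁‖ * ‖v₂‖ * ‖v₁‖ := abs_apply₃_le_of_opNorm_le _ hE₃ _ _ _
      _ ≤ M₃ * D₁ * D₂ * D₁ := by gcongr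
      _ = M₃ * D₁ ^ 2 * D₂ := by ring
  have h112 : |fderiv ℝ (fderiv ℝ (fderiv ℝ F)) (γ θ) v₁ v₁ v₂| ≤ M₃ * D₁ ^ 2 * D₂ := by
    calc _ ≤ M₃ * ‖v₁‖ * ‖v₁‖ * ‖v₂‖ := abs_apply₃_le_of_opNorm_le _ hE₃ _ _ _
      _ ≤ M₃ * D₁ * D₁ * D₂ := by gcongr
      _ = M₃ * D₁ ^ 2 * D₂ := by ring
  have h31 : |fderiv ℝ (fderiv ℝ F) (γ θ) v₃ v₁| ≤ M₂ * D₁ * D₃ := by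
    calc _ ≤ M₂ * ‖v₃‖ * ‖v₁‖ := abs_apply₂_le_of_opNorm_le _ hE₂ _ _
      _ ≤ M₂ * D₃ * D₁ := by gcongr
      _ = M₂ * D₁ * D₃ := by ring
  have h13 : |fderiv ℝ (fderiv ℝ F) (γ θ) v₁ v₃| ≤ M₂ * D₁ * D₃ := by
    calc _ ≤ M₂ * ‖v₁‖ * ‖v₃‖ := abs_apply₂_le_of_opNorm_le _ hE₂ _ _
      _ ≤ M₂ * D₁ * D₃ := by gcongr
  have h22 : |fderiv ℝ (fderiv ℝ F) (γ θ) v₂ v₂| ≤ M₂ * D₂ ^ 2 := by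
    calc _ ≤ M₂ * ‖v₂‖ * ‖v₂‖ := abs_apply₂_le_of_opNorm_le _ hE₂ _ _
      _ ≤ M₂ * D₂ * D₂ := by gcongr
      _ = M₂ * D₂ ^ 2 := by ring
  -- the fourteen terms other than `DF(γ θ)[v₄]`
  set S :=
    fderiv ℝ (fderiv ℝ (fderiv ℝ (fderiv ℝ F))) (γ θ) v₁ v₁ v₁ v₁ +
            fderiv ℝ (fderiv ℝ (fderiv ℝ F)) (γ θ) v₂ v₁ v₁ +
            fderiv ℝ (fderiv ℝ (fderiv ℝ F)) (γ θ) v₁ v₂ v₁ +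
            fderiv ℝ (fderiv ℝ (fderiv ℝ F)) (γ θ) v₁ v₁ v₂ +
          (fderiv ℝ (fderiv ℝ (fderiv ℝ F)) (γ θ) v₁ v₂ v₁ + fderiv ℝ (fderiv ℝ F) (γ θ) v₃ v₁ +
            fderiv ℝ (fderiv ℝ F) (γ θ) v₂ v₂) +
          (fderiv ℝ (fderiv ℝ (fderiv ℝ F)) (γ θ) v₁ v₁ v₂ + fderiv ℝ (fderiv ℝ F) (γ θ) v₂ v₂ +
            fderiv ℝ (fderiv ℝ F) (γ θ) v₁ v₃) +
          (fderiv ℝ (fderiv ℝ (fderiv ℝ F)) (γ θ) v₁ v₁ v₂ + fderiv ℝ (fderiv ℝ F) (γ θ) v₂ v₂ +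
            fderiv ℝ (fderiv ℝ F) (γ θ) v₁ v₃) +
        fderiv ℝ (fderiv ℝ F) (γ θ) v₁ v₃ with hSdef
  have key : fderiv ℝ F (γ θ) v₄ = iteratedDeriv 4 (F ∘ γ) θ - S := by
    rw [heq, hSdef]; ring
  have hS : |S| ≤ M₄ * D₁ ^ 4 + 6 * M₃ * D₁ ^ 2 * D₂ + 3 * M₂ * D₂ ^ 2 + 4 * M₂ * D₁ * D₃ := by
    have hM := abs_add_le_add (abs_add_le_add (abs_add_le_add (abs_add_le_add
      (abs_add_le_add (abs_add_le_add (abs_add_le_add h4 h211) h121) h112)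
      (abs_add_le_add (abs_add_le_add h121 h31) h22))
      (abs_add_le_add (abs_add_le_add h112 h22) h13))
      (abs_add_le_add (abs_add_le_add h112 h22) h13)) h13
    rw [hSdef]
    refine hM.trans (le_of_eq ?_)
    ring
  rw [key]
  exact (abs_sub _ _).trans (add_le_add le_rfl hS)

end Four

end Reverse

end Summit.HubbardSuperconductivity.HubbardSuperconductivity.Theorems.PerturbedFermiCurve

/-! ## §2 Model reading: the stub-6 profile as a composite, and what `TwoLegCurveJetBound` forces on the inherited terms -/

namespace Summit.HubbardSuperconductivity.HubbardSuperconductivity.Theorems.KLRegimeSplit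

set_option linter.dupNamespace false -- summit = problem name (single-conjunct summit), D-0017
set_option maxSynthPendingDepth 3

open Real Literature.MathematicalPhysics.QuantumLattice Literature.Probability.LatticeModels
open Summit.HubbardSuperconductivity.HubbardSuperconductivity.Theorems.PerturbedFermiCurve

section Model

variable {L M : ℕ} [NeZero L] [NeZero M]

/-- **The scale-`(n+1)` profile is a composite**: `δ_{n+1} = evalM (symInterp L (σ_{n+1} − σ_n)) ∘ (toLp ∘ k_F^K)` — the
momentum-space increment read along the Fermi-point map of the FULL frame `K`. -/
theorem klTwoLegCurveProfile_succ_eq_comp (β U μ : ℝ) (K : TrigPolyC4v) (n : ℕ) :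
    klTwoLegCurveProfile L M β U μ K (n + 1) =
      evalM (symInterp L fun k => klLocSelfEnergyRe L M β U μ K (n + 1) k - klLocSelfEnergyRe L M β U μ K n k) ∘
        fun θ => (WithLp.toLp 2 (klFermiPoint μ K θ) : Momentum) := by
  rw [klTwoLegCurveProfile_succ]
  exact klLocalPart_sub_eq_evalM_comp β U μ K n (n + 1)

/-- **The scale-`0` profile is a composite**: `δ₀ = (evalM (symInterp L σ₀) − evalM K) ∘ (toLp ∘ k_F^K)`. -/
theorem klTwoLegCurveProfile_zero_eq_comp (β U μ : ℝ) (K : TrigPolyC4v) :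
    klTwoLegCurveProfile L M β U μ K 0 =
      (fun q : Momentum => evalM (symInterp L (klLocSelfEnergyRe L M β U μ K 0)) q - evalM K q) ∘
        fun θ => (WithLp.toLp 2 (klFermiPoint μ K θ) : Momentum) := by
  funext θ
  simp [klTwoLegCurveProfile, klLocalPart, evalM]

variable {c c' : ℕ → ℝ} {β U μ : ℝ} {K : TrigPolyC4v}

/-- **What stub 6 forces at order 4, scale `n + 1`.**  Under `TwoLegCurveJetBound L M c c' β U μ K (n+1)`, with `G` the momentum-space
increment `evalM (symInterp L (σ_{n+1} − σ_n))`, `γ = toLp ∘ k_F^K` a `C⁴` curve, `‖DᵏG(γ θ)‖ ≤ M_k` (`k = 2, 3, 4`) and `‖γ^{(i)}(θ)‖ ≤ D_i`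
(`i ≤ 3`): the INHERITED product is budget-bounded, `|DG(γ θ)[γ⁗ θ]| ≤ curveJetBar c c' U 4 (n+1) + (M₄D₁⁴ + 6M₃D₁²D₂ + 3M₂D₂² + 4M₂D₁D₃)`.
For a deep frame `‖γ⁗‖ ≍ Gfr₄U²16^{N+1}/15` while the right side is `∝ 16^{n+1}` — the memo's inconsistency at shallow `n`. -/
theorem TwoLegCurveJetBound.inherited_four_le_succ {n : ℕ} (h : TwoLegCurveJetBound L M c c' β U μ K (n + 1))
    (hγ : ContDiff ℝ 4 fun θ => (WithLp.toLp 2 (klFermiPoint μ K θ) : Momentum)) (θ : ℝ) {M₂ M₃ M₄ D₁ D₂ D₃ : ℝ}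
    (hM₂ : ‖iteratedFDeriv ℝ 2 (evalM (symInterp L fun k =>
        klLocSelfEnergyRe L M β U μ K (n + 1) k - klLocSelfEnergyRe L M β U μ K n k)) (WithLp.toLp 2 (klFermiPoint μ K θ))‖ ≤ M₂)
    (hM₃ : ‖iteratedFDeriv ℝ 3 (evalM (symInterp L fun k =>
        klLocSelfEnergyRe L M β U μ K (n + 1) k - klLocSelfEnergyRe L M β U μ K n k)) (WithLp.toLp 2 (klFermiPoint μ K θ))‖ ≤ M₃)
    (hM₄ : ‖iteratedFDeriv ℝ 4 (evalM (symInterp L fun k =>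
        klLocSelfEnergyRe L M β U μ K (n + 1) k - klLocSelfEnergyRe L M β U μ K n k)) (WithLp.toLp 2 (klFermiPoint μ K θ))‖ ≤ M₄)
    (hD₁ : ‖iteratedDeriv 1 (fun θ => (WithLp.toLp 2 (klFermiPoint μ K θ) : Momentum)) θ‖ ≤ D₁)
    (hD₂ : ‖iteratedDeriv 2 (fun θ => (WithLp.toLp 2 (klFermiPoint μ K θ) : Momentum)) θ‖ ≤ D₂)
    (hD₃ : ‖iteratedDeriv 3 (fun θ => (WithLp.toLp 2 (klFermiPoint μ K θ) : Momentum)) θ‖ ≤ D₃) :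
    |fderiv ℝ (evalM (symInterp L fun k => klLocSelfEnergyRe L M β U μ K (n + 1) k - klLocSelfEnergyRe L M β U μ K n k))
        (WithLp.toLp 2 (klFermiPoint μ K θ))
        (iteratedDeriv 4 (fun θ => (WithLp.toLp 2 (klFermiPoint μ K θ) : Momentum)) θ)| ≤
      curveJetBar c c' U 4 (n + 1) + (M₄ * D₁ ^ 4 + 6 * M₃ * D₁ ^ 2 * D₂ + 3 * M₂ * D₂ ^ 2 + 4 * M₂ * D₁ * D₃) := by
  set G := evalM (symInterp L fun k => klLocSelfEnergyRe L M β U μ K (n + 1) k - klLocSelfEnergyRe L M β U μ K n k) with hG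
  set γ : ℝ → Momentum := fun θ => (WithLp.toLp 2 (klFermiPoint μ K θ) : Momentum) with hγdef
  have hGc : ContDiff ℝ 4 G := contDiff_evalM _
  have h1 := abs_fderiv_apply_iteratedDeriv_four_le_struct hGc hγ hM₂ hM₃ hM₄ hD₁ hD₂ hD₃
  have h2 := h.le (show (4 : ℕ) ≤ 4 from le_rfl) θ
  rw [klTwoLegCurveProfile_succ_eq_comp] at h2
  exact h1.trans (add_le_add h2 le_rfl)

/-- **What stub 6 forces at order 3, scale `n + 1`**: `|DG(γ θ)[γ‴ θ]| ≤ curveJetBar c c' U 3 (n+1) + (M₃D₁³ + 3M₂D₁D₂)`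
(deep frame: `‖γ‴‖ ≍ Gfr₃U²4^{N+1}/3`, right side `∝ 4^{n+1}`). -/
theorem TwoLegCurveJetBound.inherited_three_le_succ {n : ℕ} (h : TwoLegCurveJetBound L M c c' β U μ K (n + 1))
    (hγ : ContDiff ℝ 4 fun θ => (WithLp.toLp 2 (klFermiPoint μ K θ) : Momentum)) (θ : ℝ) {M₂ M₃ D₁ D₂ : ℝ}
    (hM₂ : ‖iteratedFDeriv ℝ 2 (evalM (symInterp L fun k =>
        klLocSelfEnergyRe L M β U μ K (n + 1) k - klLocSelfEnergyRe L M β U μ K n k)) (WithLp.toLp 2 (klFermiPoint μ K θ))‖ ≤ M₂)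
    (hM₃ : ‖iteratedFDeriv ℝ 3 (evalM (symInterp L fun k =>
        klLocSelfEnergyRe L M β U μ K (n + 1) k - klLocSelfEnergyRe L M β U μ K n k)) (WithLp.toLp 2 (klFermiPoint μ K θ))‖ ≤ M₃)
    (hD₁ : ‖iteratedDeriv 1 (fun θ => (WithLp.toLp 2 (klFermiPoint μ K θ) : Momentum)) θ‖ ≤ D₁)
    (hD₂ : ‖iteratedDeriv 2 (fun θ => (WithLp.toLp 2 (klFermiPoint μ K θ) : Momentum)) θ‖ ≤ D₂) :
    |fderiv ℝ (evalM (symInterp L fun k => klLocSelfEnergyRe L M β U μ K (n + 1) k - klLocSelfEnergyRe L M β U μ K n k))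
        (WithLp.toLp 2 (klFermiPoint μ K θ))
        (iteratedDeriv 3 (fun θ => (WithLp.toLp 2 (klFermiPoint μ K θ) : Momentum)) θ)| ≤
      curveJetBar c c' U 3 (n + 1) + (M₃ * D₁ ^ 3 + 3 * M₂ * D₁ * D₂) := by
  set G := evalM (symInterp L fun k => klLocSelfEnergyRe L M β U μ K (n + 1) k - klLocSelfEnergyRe L M β U μ K n k) with hG
  have hGc : ContDiff ℝ 4 G := contDiff_evalM _
  have h1 := abs_fderiv_apply_iteratedDeriv_three_le_struct hGc hγ hM₂ hM₃ hD₁ hD₂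
  have h2 := h.le (show (3 : ℕ) ≤ 4 by norm_num) θ
  rw [klTwoLegCurveProfile_succ_eq_comp] at h2
  exact h1.trans (add_le_add h2 le_rfl)

/-- **What stub 6 forces at order 4, scale `0`** (`G₀ = evalM (symInterp L σ₀) − evalM K`; here `HistP … 0` is vacuous in the stub, so this
is the cleanest instance): `|DG₀(γ θ)[γ⁗ θ]| ≤ curveJetBar c c' U 4 0 + (M₄D₁⁴ + 6M₃D₁²D₂ + 3M₂D₂² + 4M₂D₁D₃)`,
`curveJetBar c c' U 4 0 = (c 4 + c' 4·|U|)·U²`. -/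
theorem TwoLegCurveJetBound.inherited_four_le_zero (h : TwoLegCurveJetBound L M c c' β U μ K 0)
    (hγ : ContDiff ℝ 4 fun θ => (WithLp.toLp 2 (klFermiPoint μ K θ) : Momentum)) (θ : ℝ) {M₂ M₃ M₄ D₁ D₂ D₃ : ℝ}
    (hM₂ : ‖iteratedFDeriv ℝ 2 (fun q : Momentum => evalM (symInterp L (klLocSelfEnergyRe L M β U μ K 0)) q - evalM K q)
        (WithLp.toLp 2 (klFermiPoint μ K θ))‖ ≤ M₂)
    (hM₃ : ‖iteratedFDeriv ℝ 3 (fun q : Momentum => evalM (symInterp L (klLocSelfEnergyRe L M β U μ K 0)) q - evalM K q)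
        (WithLp.toLp 2 (klFermiPoint μ K θ))‖ ≤ M₃)
    (hM₄ : ‖iteratedFDeriv ℝ 4 (fun q : Momentum => evalM (symInterp L (klLocSelfEnergyRe L M β U μ K 0)) q - evalM K q)
        (WithLp.toLp 2 (klFermiPoint μ K θ))‖ ≤ M₄)
    (hD₁ : ‖iteratedDeriv 1 (fun θ => (WithLp.toLp 2 (klFermiPoint μ K θ) : Momentum)) θ‖ ≤ D₁)
    (hD₂ : ‖iteratedDeriv 2 (fun θ => (WithLp.toLp 2 (klFermiPoint μ K θ) : Momentum)) θ‖ ≤ D₂)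
    (hD₃ : ‖iteratedDeriv 3 (fun θ => (WithLp.toLp 2 (klFermiPoint μ K θ) : Momentum)) θ‖ ≤ D₃) :
    |fderiv ℝ (fun q : Momentum => evalM (symInterp L (klLocSelfEnergyRe L M β U μ K 0)) q - evalM K q)
        (WithLp.toLp 2 (klFermiPoint μ K θ))
        (iteratedDeriv 4 (fun θ => (WithLp.toLp 2 (klFermiPoint μ K θ) : Momentum)) θ)| ≤
      curveJetBar c c' U 4 0 + (M₄ * D₁ ^ 4 + 6 * M₃ * D₁ ^ 2 * D₂ + 3 * M₂ * D₂ ^ 2 + 4 * M₂ * D₁ * D₃) := by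
  set G : Momentum → ℝ := fun q => evalM (symInterp L (klLocSelfEnergyRe L M β U μ K 0)) q - evalM K q with hG
  have hGc : ContDiff ℝ 4 G := (contDiff_evalM _).sub (contDiff_evalM _)
  have h1 := abs_fderiv_apply_iteratedDeriv_four_le_struct hGc hγ hM₂ hM₃ hM₄ hD₁ hD₂ hD₃
  have h2 := h.le (show (4 : ℕ) ≤ 4 from le_rfl) θ
  rw [klTwoLegCurveProfile_zero_eq_comp] at h2
  exact h1.trans (add_le_add h2 le_rfl)

/-- **Contrapositive (the refuter's form), scale `n + 1`, order 4**: if at some angle the inherited product exceeds the scale-`(n+1)` budget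
plus the budget-shaped terms, the stub-6 predicate fails. -/
theorem not_twoLegCurveJetBound_succ_of_inherited_gt {n : ℕ}
    (hγ : ContDiff ℝ 4 fun θ => (WithLp.toLp 2 (klFermiPoint μ K θ) : Momentum)) (θ : ℝ) {M₂ M₃ M₄ D₁ D₂ D₃ : ℝ}
    (hM₂ : ‖iteratedFDeriv ℝ 2 (evalM (symInterp L fun k =>
        klLocSelfEnergyRe L M β U μ K (n + 1) k - klLocSelfEnergyRe L M β U μ K n k)) (WithLp.toLp 2 (klFermiPoint μ K θ))‖ ≤ M₂)
    (hM₃ : ‖iteratedFDeriv ℝ 3 (evalM (symInterp L fun k =>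
        klLocSelfEnergyRe L M β U μ K (n + 1) k - klLocSelfEnergyRe L M β U μ K n k)) (WithLp.toLp 2 (klFermiPoint μ K θ))‖ ≤ M₃)
    (hM₄ : ‖iteratedFDeriv ℝ 4 (evalM (symInterp L fun k =>
        klLocSelfEnergyRe L M β U μ K (n + 1) k - klLocSelfEnergyRe L M β U μ K n k)) (WithLp.toLp 2 (klFermiPoint μ K θ))‖ ≤ M₄)
    (hD₁ : ‖iteratedDeriv 1 (fun θ => (WithLp.toLp 2 (klFermiPoint μ K θ) : Momentum)) θ‖ ≤ D₁)
    (hD₂ : ‖iteratedDeriv 2 (fun θ => (WithLp.toLp 2 (klFermiPoint μ K θ) : Momentum)) θ‖ ≤ D₂)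
    (hD₃ : ‖iteratedDeriv 3 (fun θ => (WithLp.toLp 2 (klFermiPoint μ K θ) : Momentum)) θ‖ ≤ D₃)
    (hgt : curveJetBar c c' U 4 (n + 1) + (M₄ * D₁ ^ 4 + 6 * M₃ * D₁ ^ 2 * D₂ + 3 * M₂ * D₂ ^ 2 + 4 * M₂ * D₁ * D₃) <
      |fderiv ℝ (evalM (symInterp L fun k => klLocSelfEnergyRe L M β U μ K (n + 1) k - klLocSelfEnergyRe L M β U μ K n k))
        (WithLp.toLp 2 (klFermiPoint μ K θ))
        (iteratedDeriv 4 (fun θ => (WithLp.toLp 2 (klFermiPoint μ K θ) : Momentum)) θ)|) :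
    ¬ TwoLegCurveJetBound L M c c' β U μ K (n + 1) :=
  fun h => (lt_irrefl _) ((h.inherited_four_le_succ hγ θ hM₂ hM₃ hM₄ hD₁ hD₂ hD₃).trans_lt hgt)

/-- **Contrapositive, scale `0`, order 4.** -/
theorem not_twoLegCurveJetBound_zero_of_inherited_gt
    (hγ : ContDiff ℝ 4 fun θ => (WithLp.toLp 2 (klFermiPoint μ K θ) : Momentum)) (θ : ℝ) {M₂ M₃ M₄ D₁ D₂ D₃ : ℝ}
    (hM₂ : ‖iteratedFDeriv ℝ 2 (fun q : Momentum => evalM (symInterp L (klLocSelfEnergyRe L M β U μ K 0)) q - evalM K q)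
        (WithLp.toLp 2 (klFermiPoint μ K θ))‖ ≤ M₂)
    (hM₃ : ‖iteratedFDeriv ℝ 3 (fun q : Momentum => evalM (symInterp L (klLocSelfEnergyRe L M β U μ K 0)) q - evalM K q)
        (WithLp.toLp 2 (klFermiPoint μ K θ))‖ ≤ M₃)
    (hM₄ : ‖iteratedFDeriv ℝ 4 (fun q : Momentum => evalM (symInterp L (klLocSelfEnergyRe L M β U μ K 0)) q - evalM K q)
        (WithLp.toLp 2 (klFermiPoint μ K θ))‖ ≤ M₄)
    (hD₁ : ‖iteratedDeriv 1 (fun θ => (WithLp.toLp 2 (klFermiPoint μ K θ) : Momentum)) θ‖ ≤ D₁)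
    (hD₂ : ‖iteratedDeriv 2 (fun θ => (WithLp.toLp 2 (klFermiPoint μ K θ) : Momentum)) θ‖ ≤ D₂)
    (hD₃ : ‖iteratedDeriv 3 (fun θ => (WithLp.toLp 2 (klFermiPoint μ K θ) : Momentum)) θ‖ ≤ D₃)
    (hgt : curveJetBar c c' U 4 0 + (M₄ * D₁ ^ 4 + 6 * M₃ * D₁ ^ 2 * D₂ + 3 * M₂ * D₂ ^ 2 + 4 * M₂ * D₁ * D₃) <
      |fderiv ℝ (fun q : Momentum => evalM (symInterp L (klLocSelfEnergyRe L M β U μ K 0)) q - evalM K q)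
        (WithLp.toLp 2 (klFermiPoint μ K θ))
        (iteratedDeriv 4 (fun θ => (WithLp.toLp 2 (klFermiPoint μ K θ) : Momentum)) θ)|) :
    ¬ TwoLegCurveJetBound L M c c' β U μ K 0 :=
  fun h => (lt_irrefl _) ((h.inherited_four_le_zero hγ θ hM₂ hM₃ hM₄ hD₁ hD₂ hD₃).trans_lt hgt)

end Model

end Summit.HubbardSuperconductivity.HubbardSuperconductivity.Theorems.KLRegimeSplit

end
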